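import Literature.Claims.NS.ClayPeriodicBlowupAlternative
import Literature.Analysis.FluidPDE.TorusNSStrainSupContinuation
import Literature.Analysis.FluidPDE.TaoEnstrophyLocalisation
import HarnessLib

/-!
# Periodic Clay solvability from a time-integrable sup bound on the strain-rate tensor
# (the Beale–Kato–Majda mechanism in strain form, `ℝ³`-periodic formulation)

Claims/NS support file next to `ClayPeriodicBlowupAlternative` (theorems only; no definitions, no
named facts). For `ν > 0` and a classical solution `(u, p)` of the unforced Navier–Stokes system on
`[0, T) × ℝ³` with `ℤ³`-periodic velocity and pressure slices, write
`S(t, x) = ½(∇u(t, x) + ∇u(t, x)ᵀ)` (as the operator `½(Du + Du†)` on `ℝ³`). If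
`∫₀ᵀ sup_x ‖S(t, x)‖ dt < ∞` (lower Lebesgue integral of the `ℝ≥0∞`-valued sup — no measurability
side condition), then the enstrophy per period cell stays bounded on `[0, T)`
(`bddAbove_enstrophy_of_strainSup_lintegral_lt_top`); consequently a smooth divergence-free periodic
datum all of whose periodic classical solutions obey such a bound on every `[0, T)` is solvable in
Fefferman's printed class (10) (`clayPeriodic_solvable_of_aprioriStrainSup`), and the a priori strain
bound at every viscosity gives Clay (B) (`clayPeriodic_regularity_of_aprioriStrainSup`).

Proof: descend to the flat torus (`torus_descend_of_periodic`), take the continuous entrywise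
majorant `M(t) = max_{|x| ≤ 2} ‖S(t, x)‖` (= the sup over `ℝ³` by periodicity; a parametric maximum
over a compact set, `IsCompact.continuous_sSup`), whose primitive is bounded by the given integral,
and apply the tree's strain-form enstrophy Grönwall bound
`Torus.torusEnstrophy_le_mul_exp_integral_strainBound` (BKM 1984 / Ponce 1985 mechanism; RRS 2016,
§6.3, §8.1 for the enstrophy door) together with the blow-up alternative
`clayPeriodic_solvable_or_gradientSupBlowup`.

Consumer: cell `ns-claims`, row C144 `Passolungo2025` («Mini-BKM», §13 p.5 l.6–7:
`Step10_MiniBKM : ClaimedTheorem → ClaimedRegularity`).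

## References
* J. T. Beale, T. Kato, A. Majda, Comm. Math. Phys. 94 (1984) 61–66, Thm 1. [`BealeKatoMajda1984`]
* J. C. Robinson, J. L. Rodrigo, W. Sadowski, *The three-dimensional Navier–Stokes equations*,
  CUP 2016, §6.3, §8.1, Thm 12.3. [`RobinsonRodrigoSadowskiCUP2016`]
* C. L. Fefferman, CMI problem description (2006), (B) with (8) (10) (11), p. 2. [`FeffermanClay2006`]

WHAT THIS IS NOT: not a claim about NS regularity or blow-up; not a claim about any author beyond the
typed locator.
-/

noncomputable section

open scoped ContDiff ENNReal Topology InnerProductSpace RealInnerProductSpace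

namespace Literature.Claims.NS.ClayVariants

open Set Filter MeasureTheory Function Literature.Analysis Literature.Analysis.FluidPDE
open Literature.Analysis.FunctionSpaces

/-! ## Two pointwise facts -/

/-- The period cell `[0,1)³` lies in the closed ball of radius `2`. [folklore] -/
private theorem unitCube_subset_closedBall :
    Torus.unitCube (Fin 3) ⊆ Metric.closedBall (0 : EuclideanSpace ℝ (Fin 3)) 2 := by
  intro x hx
  rw [Metric.mem_closedBall, dist_zero_right]
  have h0 := hx 0
  have h1 := hx 1
  have h2 := hx 2
  simp only [mem_Ico] at h0 h1 h2
  have hsq : ‖x‖ ^ 2 ≤ 4 := by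
    rw [EuclideanSpace.real_norm_sq_eq, Fin.sum_univ_three]
    nlinarith
  nlinarith [norm_nonneg x]

/-- The symmetrised entries of an operator `D` on `ℝ³` are bounded by the operator norm of
`½(D + D†)`: `|((D eⱼ)ᵢ + (D eᵢ)ⱼ)/2| = |⟪½(D + D†) eⱼ, eᵢ⟫| ≤ ‖½(D + D†)‖`. [folklore] -/
private theorem abs_symm_entry_le (D : EuclideanSpace ℝ (Fin 3) →L[ℝ] EuclideanSpace ℝ (Fin 3))
    (i j : Fin 3) :
    |((D (EuclideanSpace.single j 1)) i + (D (EuclideanSpace.single i 1)) j) / 2| ≤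
      ‖(1 / 2 : ℝ) • (D + ContinuousLinearMap.adjoint D)‖ := by
  set S := (1 / 2 : ℝ) • (D + ContinuousLinearMap.adjoint D) with hS
  have hSv : S (EuclideanSpace.single j 1) =
      (1 / 2 : ℝ) • (D (EuclideanSpace.single j 1) +
        ContinuousLinearMap.adjoint D (EuclideanSpace.single j 1)) := rfl
  have key : ((D (EuclideanSpace.single j 1)) i + (D (EuclideanSpace.single i 1)) j) / 2 =
      ⟪S (EuclideanSpace.single j 1), EuclideanSpace.single i 1⟫_ℝ := by
    rw [hSv, real_inner_smul_left, inner_add_left, ContinuousLinearMap.adjoint_inner_left,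
      EuclideanSpace.inner_single_right, EuclideanSpace.inner_single_left]
    simp only [RCLike.conj_to_real, one_mul, map_one]
    ring
  rw [key]
  calc |⟪S (EuclideanSpace.single j 1), EuclideanSpace.single i 1⟫_ℝ|
      ≤ ‖S (EuclideanSpace.single j 1)‖ * ‖(EuclideanSpace.single i (1 : ℝ))‖ :=
        abs_real_inner_le_norm _ _
    _ ≤ ‖S‖ * ‖(EuclideanSpace.single j (1 : ℝ))‖ * ‖(EuclideanSpace.single i (1 : ℝ))‖ := by
        gcongr
        exact S.le_opNorm _
    _ = ‖S‖ := by simp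

/-! ## The enstrophy stays bounded under `∫₀ᵀ sup‖S‖ < ∞` -/

variable {ν : ℝ} {u₀ : EuclideanSpace ℝ (Fin 3) → EuclideanSpace ℝ (Fin 3)}

/-- **A time-integrable sup bound on the strain rate bounds the enstrophy (periodic, classical).**
For `ν > 0` and a classical solution `(u, p)` of the unforced system on `[0, T) × ℝ³` with
`ℤ³`-periodic `u(·,t)`, `p(·,t)`: if `∫⁻_{(0,T)} supₓ ‖½(Du + Du†)(t, x)‖ < ∞`, the enstrophy per
period cell `∫_{𝕋³} Σᵢ ‖∂ᵢu(t)‖²` is bounded above on `[0, T)` — by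
`2 ℰ(0) exp(8 ∫₀ᵀ sup‖S‖)` (the strain form of the enstrophy balance and Grönwall, tree
`Torus.torusEnstrophy_le_mul_exp_integral_strainBound`, with the continuous majorant
`M(t) = max_{|x|≤2} ‖S(t,x)‖`). [cite: BealeKatoMajda1984, Thm 1 (mechanism, strain form)] [cite: RobinsonRodrigoSadowskiCUP2016, §6.3 and §8.1] -/
theorem bddAbove_enstrophy_of_strainSup_lintegral_lt_top (hν : 0 < ν) {T : ℝ}
    {u : ℝ → EuclideanSpace ℝ (Fin 3) → EuclideanSpace ℝ (Fin 3)}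
    {p : ℝ → EuclideanSpace ℝ (Fin 3) → ℝ}
    (hcl : FluidPDE.IsClassicalNSSolutionOn (Ico 0 T) ν 0 u p)
    (hperT : ∀ t ∈ Ico 0 T, IsLatticePeriodic (u t) ∧ IsLatticePeriodic (p t))
    (hfin : (∫⁻ t in Ioo 0 T, ⨆ x : EuclideanSpace ℝ (Fin 3),
        ‖(1 / 2 : ℝ) • (fderiv ℝ (u t) x + ContinuousLinearMap.adjoint (fderiv ℝ (u t) x))‖ₑ) < ⊤) :
    BddAbove ((fun t => Torus.gradNormSq (fun x => u t (Torus.repr x))) '' Ico 0 T) := by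
  -- the torus reading of the solution
  obtain ⟨hU, hlift⟩ := torus_descend_of_periodic hcl hperT
  set U : ℝ → UnitAddTorus (Fin 3) → EuclideanSpace ℝ (Fin 3) := fun t x => u t (Torus.repr x)
    with hUdef
  -- the strain operator field, the compact window and the majorant
  set Sx : ℝ → EuclideanSpace ℝ (Fin 3) → (EuclideanSpace ℝ (Fin 3) →L[ℝ] EuclideanSpace ℝ (Fin 3)) :=
    fun s x => (1 / 2 : ℝ) • (fderiv ℝ (u s) x + ContinuousLinearMap.adjoint (fderiv ℝ (u s) x))
    with hSx
  set K : Set (EuclideanSpace ℝ (Fin 3)) := Metric.closedBall 0 2 with hK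
  have hKc : IsCompact K := isCompact_closedBall _ _
  have hKne : K.Nonempty := ⟨0, Metric.mem_closedBall_self (by norm_num)⟩
  set M : ℝ → ℝ := fun s => sSup ((fun x => ‖Sx s x‖) '' K) with hM
  -- joint continuity of the strain field on `[0,T) × ℝ³`
  have hcontD : ContinuousOn (uncurry fun s x => fderiv ℝ (u s) x) (Ico 0 T ×ˢ univ) :=
    (hcl.smooth_velocity.fderiv_slice (uniqueDiffOn_Ico 0 T)).continuousOn
  have hadj : Continuous fun D : EuclideanSpace ℝ (Fin 3) →L[ℝ] EuclideanSpace ℝ (Fin 3) =>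
      ContinuousLinearMap.adjoint D :=
    (ContinuousLinearMap.adjoint :
      (EuclideanSpace ℝ (Fin 3) →L[ℝ] EuclideanSpace ℝ (Fin 3)) ≃ₗᵢ⋆[ℝ]
        (EuclideanSpace ℝ (Fin 3) →L[ℝ] EuclideanSpace ℝ (Fin 3))).continuous
  have hcontS : ContinuousOn (uncurry fun s x => ‖Sx s x‖) (Ico 0 T ×ˢ univ) :=
    ((hcontD.add (hadj.comp_continuousOn hcontD)).const_smul (1 / 2 : ℝ)).norm
  have hcontx : ∀ s ∈ Ico 0 T, Continuous fun x => ‖Sx s x‖ := by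
    intro s hs
    have h := hcontS.comp_continuous (continuous_const.prodMk continuous_id)
      (fun x => mk_mem_prod hs (mem_univ x))
    exact h
  -- periodicity: the derivative at `x` is the derivative at the representative of `x`
  have hDrepr : ∀ s ∈ Ico 0 T, ∀ x,
      fderiv ℝ (u s) x = fderiv ℝ (u s) (Torus.repr (Torus.proj x)) := by
    intro s hs x
    rw [← hlift s hs, Torus.fderiv_lift, Torus.fderiv_lift, Torus.proj_repr]
  -- `M` majorises, is attained, is nonnegative
  have hle_M : ∀ s ∈ Ico 0 T, ∀ x, ‖Sx s x‖ ≤ M s := by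
    intro s hs x
    have hx' : Torus.repr (Torus.proj x) ∈ K :=
      unitCube_subset_closedBall (Torus.repr_mem_unitCube _)
    have heq : Sx s x = Sx s (Torus.repr (Torus.proj x)) := by
      simp only [hSx, hDrepr s hs x]
    rw [heq]
    exact le_csSup (hKc.bddAbove_image (hcontx s hs).continuousOn) (mem_image_of_mem _ hx')
  have hM_att : ∀ s ∈ Ico 0 T, ∃ x ∈ K, M s = ‖Sx s x‖ := fun s hs =>
    hKc.exists_sSup_image_eq hKne (hcontx s hs).continuousOn
  have hM0 : ∀ s ∈ Ico 0 T, 0 ≤ M s := by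
    intro s hs
    obtain ⟨x, -, hx⟩ := hM_att s hs
    rw [hx]
    exact norm_nonneg _
  have hofReal_le : ∀ s ∈ Ico 0 T,
      ENNReal.ofReal (M s) ≤ ⨆ x : EuclideanSpace ℝ (Fin 3), ‖Sx s x‖ₑ := by
    intro s hs
    obtain ⟨x, -, hx⟩ := hM_att s hs
    rw [hx, ofReal_norm]
    exact le_iSup (fun y => ‖Sx s y‖ₑ) x
  -- continuity of `M` on `[0,T)` (parametric maximum over the compact window)
  have hMc : ContinuousOn M (Ico 0 T) := by
    rw [continuousOn_iff_continuous_restrict]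
    have hF : Continuous (↿fun (s : Ico 0 T) (x : EuclideanSpace ℝ (Fin 3)) => ‖Sx s x‖) := by
      have h := hcontS.comp_continuous
        (f := fun q : Ico 0 T × EuclideanSpace ℝ (Fin 3) => ((q.1 : ℝ), q.2))
        (by fun_prop) (fun q => mk_mem_prod q.1.2 (mem_univ _))
      exact h
    exact hKc.continuous_sSup hF
  -- entrywise strain bound on the torus
  have hS : ∀ s ∈ Ico 0 T, ∀ y, ∀ i j,
      |(Torus.partialDeriv j (U s) y i + Torus.partialDeriv i (U s) y j) / 2| ≤ M s := by
    intro s hs y i j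
    have hC1 : Torus.IsContDiff 1 (U s) := (hU.smooth_velocity.isSmooth_slice hs).isContDiff (by simp)
    have hD : Torus.fderiv (U s) y = fderiv ℝ (u s) (Torus.repr y) := by
      rw [← hlift s hs, Torus.fderiv_lift, Torus.proj_repr]
    rw [Torus.partialDeriv_eq_fderiv_apply hC1, Torus.partialDeriv_eq_fderiv_apply hC1, hD]
    exact (abs_symm_entry_le _ i j).trans (hle_M s hs _)
  -- the primitive of `M` is bounded by the given integral
  set I : ℝ := (∫⁻ t in Ioo 0 T, ⨆ x : EuclideanSpace ℝ (Fin 3), ‖Sx t x‖ₑ).toReal with hI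
  have hIbd : ∀ t ∈ Ico 0 T, ∫ s in (0 : ℝ)..t, M s ≤ I := by
    intro t ht
    have hIoc : Ioc 0 t ⊆ Ico 0 T := fun s hs => ⟨hs.1.le, hs.2.trans_lt ht.2⟩
    have hIoo : Ioc 0 t ⊆ Ioo 0 T := fun s hs => ⟨hs.1, hs.2.trans_lt ht.2⟩
    have hnn : 0 ≤ᵐ[volume.restrict (Ioc 0 t)] M :=
      (ae_restrict_iff' measurableSet_Ioc).2 (ae_of_all _ fun s hs => hM0 s (hIoc hs))
    have hms : AEStronglyMeasurable M (volume.restrict (Ioc 0 t)) :=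
      (hMc.mono hIoc).aestronglyMeasurable measurableSet_Ioc
    rw [intervalIntegral.integral_of_le ht.1, integral_eq_lintegral_of_nonneg_ae hnn hms]
    refine ENNReal.toReal_mono hfin.ne ?_
    calc ∫⁻ s in Ioc 0 t, ENNReal.ofReal (M s)
        ≤ ∫⁻ s in Ioc 0 t, ⨆ x : EuclideanSpace ℝ (Fin 3), ‖Sx s x‖ₑ :=
          lintegral_mono_ae ((ae_restrict_iff' measurableSet_Ioc).2
            (ae_of_all _ fun s hs => hofReal_le s (hIoc hs)))
      _ ≤ ∫⁻ s in Ioo 0 T, ⨆ x : EuclideanSpace ℝ (Fin 3), ‖Sx s x‖ₑ := lintegral_mono_set hIoo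
  have hI0 : 0 ≤ I := ENNReal.toReal_nonneg
  -- Grönwall on each `[0, t] ⊆ [0, T)`
  refine ⟨2 * (torusEnstrophy (U 0) * Real.exp (8 * I)), ?_⟩
  rintro _ ⟨t, ht, rfl⟩
  show Torus.gradNormSq (U t) ≤ _
  rw [gradNormSq_eq_two_mul_torusEnstrophy]
  have hE0 : 0 ≤ torusEnstrophy (U 0) := torusEnstrophy_nonneg _
  have hone : 1 ≤ Real.exp (8 * I) := Real.one_le_exp (by positivity)
  rcases ht.1.eq_or_lt with h0 | h0t
  · rw [← h0]
    nlinarith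
  · have hsub : Icc 0 t ⊆ Ico 0 T := fun s hs => ⟨hs.1, hs.2.trans_lt ht.2⟩
    have hmain := Torus.torusEnstrophy_le_mul_exp_integral_strainBound (d := Fin 3) (by simp)
      hν.le h0t (hU.mono hsub (uniqueDiffOn_Icc h0t)) (hMc.mono hsub)
      (fun s hs => hM0 s (hsub hs)) (fun s hs => hS s (hsub hs)) ⟨h0t.le, le_rfl⟩
    have hexp : Real.exp (8 * ∫ s in (0 : ℝ)..t, M s) ≤ Real.exp (8 * I) :=
      Real.exp_le_exp.2 (by linarith [hIbd t ht])
    nlinarith [mul_le_mul_of_nonneg_left hexp hE0]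

/-! ## Solvability and Clay (B) from the a priori strain bound -/

/-- **The a priori bound `∫₀ᵀ sup‖S‖ < ∞` along every periodic classical solution from `u₀` gives
printed-(10) solvability of `(ν, 0, u₀)`** (blow-up alternative
`clayPeriodic_solvable_or_gradientSupBlowup`, enstrophy branch, against
`bddAbove_enstrophy_of_strainSup_lintegral_lt_top`). [cite: FeffermanClay2006, (B) with (8) (10) (11) p. 2] [cite: BealeKatoMajda1984, Thm 1 (mechanism, strain form)] -/
theorem clayPeriodic_solvable_of_aprioriStrainSup (hν : 0 < ν) (hu₀ : ContDiff ℝ ∞ u₀)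
    (hdiv : NSWave0.IsDivFree u₀) (hper : IsLatticePeriodic u₀)
    (hS : ∀ (T : ℝ) (u : ℝ → EuclideanSpace ℝ (Fin 3) → EuclideanSpace ℝ (Fin 3))
      (p : ℝ → EuclideanSpace ℝ (Fin 3) → ℝ),
      FluidPDE.IsClassicalNSSolutionOn (Ico 0 T) ν 0 u p → u 0 = u₀ →
      (∀ t ∈ Ico 0 T, IsLatticePeriodic (u t) ∧ IsLatticePeriodic (p t)) →
        (∫⁻ t in Ioo 0 T, ⨆ x : EuclideanSpace ℝ (Fin 3),
          ‖(1 / 2 : ℝ) • (fderiv ℝ (u t) x + ContinuousLinearMap.adjoint (fderiv ℝ (u t) x))‖ₑ) < ⊤) :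
    clayPeriodic.Solvable ν 0 u₀ := by
  rcases clayPeriodic_solvable_or_gradientSupBlowup hν hu₀ hdiv hper with
    hsol | ⟨T, -, u, p, hcl, hu0, hperT, -, hnb, -⟩
  · exact hsol
  · exact absurd (bddAbove_enstrophy_of_strainSup_lintegral_lt_top hν hcl hperT
      (hS T u p hcl hu0 hperT)) hnb

/-- **Clay (B) from the a priori strain-sup bound at every viscosity**: if for every `ν > 0`, every
smooth divergence-free `ℤ³`-periodic datum and every periodic classical solution on `[0, T) × ℝ³` one
has `∫₀ᵀ sup‖S‖ < ∞`, then `clayPeriodic.Regularity` (the leaf `NavierStokesExistenceSmoothPeriodic`,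
`clayPeriodic_regularity_iff`). [cite: FeffermanClay2006, (B) with (8) (10) (11) p. 2] [cite: BealeKatoMajda1984, Thm 1 (mechanism, strain form)] -/
theorem clayPeriodic_regularity_of_aprioriStrainSup
    (hS : ∀ ν : ℝ, 0 < ν → ∀ (u₀ : EuclideanSpace ℝ (Fin 3) → EuclideanSpace ℝ (Fin 3)),
      ContDiff ℝ ∞ u₀ → NSWave0.IsDivFree u₀ → IsLatticePeriodic u₀ →
      ∀ (T : ℝ) (u : ℝ → EuclideanSpace ℝ (Fin 3) → EuclideanSpace ℝ (Fin 3))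
        (p : ℝ → EuclideanSpace ℝ (Fin 3) → ℝ),
        FluidPDE.IsClassicalNSSolutionOn (Ico 0 T) ν 0 u p → u 0 = u₀ →
        (∀ t ∈ Ico 0 T, IsLatticePeriodic (u t) ∧ IsLatticePeriodic (p t)) →
          (∫⁻ t in Ioo 0 T, ⨆ x : EuclideanSpace ℝ (Fin 3),
            ‖(1 / 2 : ℝ) • (fderiv ℝ (u t) x + ContinuousLinearMap.adjoint (fderiv ℝ (u t) x))‖ₑ) < ⊤) :
    clayPeriodic.Regularity :=
  fun ν hν u₀ hu₀ hdiv hper =>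
    clayPeriodic_solvable_of_aprioriStrainSup hν hu₀ hdiv hper (hS ν hν u₀ hu₀ hdiv hper)

end Literature.Claims.NS.ClayVariants

end
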